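import Summits.BirchSwinnertonDyer.BirchSwinnertonDyer.Theses.ShiftedKolyvaginAtInertTwo
import HarnessLib

/-!
# The assembly item of route `ShiftedKolyvaginAtInertTwo` (stmt-BirchSwinnertonDyer-27272) BY NAME

`Assembly := RefinedKolyvaginAtInertTwo → ShiftedKolyvaginExactAtInertTwo → ShiftedExactDescentAtTwoOfFacts →
PrintCf2ComplementAtTwo → ShiftedSupplyAtInertTwoOfFacts → ModularityExistsNewform → HoffsteinLuoTwist → GrossZagierAllLevels →
MilneAnyModel → ManinConstantPrimewisePrints → CMRankZeroBSDTriple → EntireLFunctionRat → PublishedFactsCf2 → WAllCornerFTwo` —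
which is, binder for binder, the route's planner-authored deciding theorem `Theses.ShiftedKolyvaginAtInertTwo.closes`
(D-0027 §2.1). Candidate attached on the item by the cell referee (REF g7, `Cand27272.lean`: term = `closes`); landed by width
seat -w3 g2 of cell `bsd-print-cf2` (planner side task). Conditional on the route's items exactly as the Assembly states them;
nothing about BSD is asserted. BSD is not proved by any of this; no summit statement is proved by this seat.
-/

-- D-0017 layout: summit = sub-problem, so `Summit.BirchSwinnertonDyer.BirchSwinnertonDyer.…` repeats a path component.
set_option linter.dupNamespace false

namespace Summit.BirchSwinnertonDyer.BirchSwinnertonDyer.Theorems.ShiftedKolyvaginAtInertTwo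

/-- **The assembly of route `ShiftedKolyvaginAtInertTwo` holds**: it is the route's deciding theorem `closes`
(items ⟹ the registered leaf `Summit.BirchSwinnertonDyer.WAllCornerFTwo`), re-stated under the item's name.
[folklore] -/
theorem assembly_proof : Summit.BirchSwinnertonDyer.BirchSwinnertonDyer.Theses.ShiftedKolyvaginAtInertTwo.Assembly :=
  Summit.BirchSwinnertonDyer.BirchSwinnertonDyer.Theses.ShiftedKolyvaginAtInertTwo.closes

end Summit.BirchSwinnertonDyer.BirchSwinnertonDyer.Theorems.ShiftedKolyvaginAtInertTwo
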